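import Literature.AlgebraicGeometry.Resolution.MacaulayficationSecantSequences
import Mathlib.RingTheory.KrullDimension.Regular
import Mathlib.RingTheory.Ideal.MinimalPrime.Noetherian
import Mathlib.RingTheory.KrullDimension.Field
import HarnessLib

/-!
# Secant elements: the sharp form of Stacks 0B52 and prime avoidance

Topic: `Literature/AlgebraicGeometry/Resolution` (existence of parameter elements inside a given
ideal; used for CM-secant / `p`-standard systems of parameters behind Macaulayfication).

* `supportDim_quotSMulTop_lt_of_forall_notMem` — **sharp form of Stacks 0B52**: for a finite
  module `M ≠ 0` of dimension `d` over a Noetherian ring, if `x` lies in no minimal prime `𝔭` of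
  `Supp M` with `dim R/𝔭 = d`, then `dim Supp(M/xM) < dim Supp M` (Mathlib's
  `Module.supportDim_quotSMulTop_succ_le_of_notMem_minimalPrimes` asks `x` to avoid *all* minimal
  primes; Česnavičius 2021, §3.2: "neither `rᵢ` nor `rⱼ` vanishes at any point of
  `Supp(M/(r₁,…,rᵢ₋₁)M)` of maximal coheight").
* `isSecantSequence_singleton_iff` — `[x]` is secant iff `dim Supp(M/xM) < dim Supp M`.
* `exists_mem_isSecantSequence_singleton` — over a Noetherian local ring, an ideal `I` not
  contained in any top-dimensional minimal prime of `Supp M` (`dim M ≥ 1`) contains a secant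
  element `x ∈ I ∩ 𝔪` for `M` (prime avoidance).

[cite: StacksProject, Tag 0B52; Cesnavicius2021, §3.2]
-/

noncomputable section

open IsLocalRing Ideal Module Order

universe u v

namespace Literature.AlgebraicGeometry.Resolution

variable {R : Type u} [CommRing R] {M : Type v} [AddCommGroup M] [Module R M]

/-! ## The sharp form of Stacks 0B52 -/

/-- `dim R/𝔭 ≤ dim Supp M` for a prime `𝔭 ⊇ Ann M` (`V(𝔭) ⊆ Supp M`). [folklore] -/
theorem ringKrullDim_quotient_le_supportDim [Module.Finite R M] {p : Ideal R} [p.IsPrime]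
    (hp : Module.annihilator R M ≤ p) : ringKrullDim (R ⧸ p) ≤ Module.supportDim R M := by
  rw [ringKrullDim_quotient, Module.supportDim, Module.support_eq_zeroLocus]
  exact krullDim_le_of_strictMono
    (fun q => ⟨q.1, PrimeSpectrum.zeroLocus_anti_mono hp q.2⟩) (fun _ _ h => h)

/-- **Stacks 0B52, sharp form.** Let `M ≠ 0` be a finite module of finite dimension `d` over a
Noetherian ring and `x ∈ R` an element outside every minimal prime `𝔭` of `Supp M` with
`dim R/𝔭 = d`. Then `dim Supp(M/xM) < dim Supp M`. Proof: a chain of primes of length `d` in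
`Supp(M/xM) = Supp M ∩ V(x)` starts above a minimal prime `𝔭` of `Supp M`; if `dim R/𝔭 = d`
then `x ∉ 𝔭` and the chain extends by `𝔭`, giving length `d + 1` in `Supp M`; otherwise the chain
lies in `V(𝔭)`, of dimension `< d`. [cite: StacksProject, Tag 0B52] -/
theorem supportDim_quotSMulTop_lt_of_forall_notMem [IsNoetherianRing R] [Module.Finite R M]
    {x : R} {d : ℕ} (hd : Module.supportDim R M = d)
    (hx : ∀ p ∈ (Module.annihilator R M).minimalPrimes, ringKrullDim (R ⧸ p) = d → x ∉ p) :
    Module.supportDim R (QuotSMulTop x M) < Module.supportDim R M := by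
  by_contra hlt
  rw [not_lt] at hlt
  -- a chain of length `d` in `Supp(M/xM)`
  have hle : (d : WithBot ℕ∞) ≤ Module.supportDim R (QuotSMulTop x M) := hd ▸ hlt
  rw [Module.supportDim] at hle
  obtain ⟨p, hp⟩ := le_krullDim_iff.mp hle
  have hhead : (p.head : PrimeSpectrum R) ∈ Module.support R M ∩ PrimeSpectrum.zeroLocus {x} := by
    rw [← Module.support_quotSMulTop]; exact p.head.2
  rw [Set.mem_inter_iff, PrimeSpectrum.mem_zeroLocus, Set.singleton_subset_iff] at hhead
  have le : Module.support R (QuotSMulTop x M) ⊆ Module.support R M := by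
    rw [Module.support_quotSMulTop]; exact Set.inter_subset_left
  let q : LTSeries (Module.support R M) :=
    p.map (Set.MapsTo.restrict id _ _ le) (fun _ _ h => h)
  have hqhead : (q.head : PrimeSpectrum R) = p.head := rfl
  have hqlen : q.length = d := by rw [← hp]; rfl
  -- a minimal prime `r ≤ q.head` of `Supp M`
  obtain ⟨r, hrm, hr⟩ := Ideal.exists_minimalPrimes_le
    (Module.mem_support_iff_of_finite.mp q.head.2)
  haveI hrp : r.IsPrime := hrm.1.1
  have hrsupp : Module.annihilator R M ≤ r := hrm.1.2
  by_cases htop : ringKrullDim (R ⧸ r) = d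
  · -- `x ∉ r`, so `r < q.head` and the chain extends to length `d + 1` in `Supp M`
    have hxr : x ∉ r := hx r hrm htop
    have hne : (⟨⟨r, hrp⟩, Module.mem_support_iff_of_finite.mpr hrsupp⟩ : Module.support R M) <
        q.head := by
      refine lt_of_le_of_ne hr fun h => hxr ?_
      have : r = q.head.1.asIdeal := congrArg (fun z : Module.support R M => z.1.asIdeal) h
      rw [this, hqhead]
      exact hhead.2
    have h1 := LTSeries.length_le_krullDim (q.cons _ hne)
    rw [RelSeries.cons_length, hqlen] at h1
    have h2 : krullDim (Module.support R M) = d := hd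
    rw [h2] at h1
    have : d + 1 ≤ d := by exact_mod_cast h1
    omega
  · -- the chain lies in `V(r)`, of dimension `< d`
    have hdim : ringKrullDim (R ⧸ r) ≤ d := hd ▸ ringKrullDim_quotient_le_supportDim hrsupp
    have hchain : (d : WithBot ℕ∞) ≤ ringKrullDim (R ⧸ r) := by
      rw [ringKrullDim_quotient, ← hqlen]
      let q' : LTSeries (PrimeSpectrum.zeroLocus (R := R) (r : Set R)) :=
        ⟨q.length, fun i => ⟨(q i).1, show (r : Set R) ⊆ (q i).1.asIdeal from
          hr.trans (q.strictMono.monotone (Fin.zero_le i) : q.head ≤ q i)⟩, fun i => q.step i⟩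
      exact q'.length_le_krullDim
    exact htop (le_antisymm hdim hchain)

/-! ## Secant elements -/

/-- `[x]` is secant for `M` iff `dim Supp(M/xM) < dim Supp M`. [folklore] -/
theorem isSecantSequence_singleton_iff (x : R) :
    IsSecantSequence M [x] ↔ Module.supportDim R (QuotSMulTop x M) < Module.supportDim R M := by
  rw [isSecantSequence_cons_iff]
  exact ⟨fun h => h.1, fun h => ⟨h, IsSecantSequence.nil⟩⟩

/-- **Secant elements in a prescribed ideal** (prime avoidance): over a Noetherian local ring,
if `M ≠ 0` is finite of dimension `d ≥ 1` and the ideal `I` is contained in no minimal prime `𝔭`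
of `Supp M` with `dim R/𝔭 = d`, then some `x ∈ I ∩ 𝔪` is a secant element (parameter element)
for `M`. [cite: Cesnavicius2021, §3.2] -/
theorem exists_mem_isSecantSequence_singleton [IsNoetherianRing R] [IsLocalRing R]
    [Module.Finite R M] {d : ℕ} (hd : Module.supportDim R M = d) (hd1 : 1 ≤ d) (I : Ideal R)
    (hI : ∀ p ∈ (Module.annihilator R M).minimalPrimes, ringKrullDim (R ⧸ p) = d → ¬ I ≤ p) :
    ∃ x ∈ I, x ∈ maximalIdeal R ∧ IsSecantSequence M [x] := by
  classical
  -- the finitely many top-dimensional minimal primes of `Supp M`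
  set T : Set (Ideal R) :=
    {p | p ∈ (Module.annihilator R M).minimalPrimes ∧ ringKrullDim (R ⧸ p) = d} with hT
  have hTfin : T.Finite :=
    (Module.annihilator R M).finite_minimalPrimes_of_isNoetherianRing.subset fun _ h => h.1
  set Tf : Finset (Ideal R) := hTfin.toFinset with hTf
  have hmemTf : ∀ K, K ∈ Tf ↔ K ∈ T := fun K => hTfin.mem_toFinset
  -- `I · 𝔪 ⊄ 𝔭` for `𝔭 ∈ T`
  have havoid' : ¬ ∃ K ∈ Tf, I * maximalIdeal R ≤ K := by
    rintro ⟨K, hK, hle⟩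
    obtain ⟨hKmin, hKdim⟩ := (hmemTf K).mp hK
    haveI hKp : K.IsPrime := hKmin.1.1
    rcases hKp.mul_le.mp hle with h | h
    · exact hI K hKmin hKdim h
    · have hKm : K = maximalIdeal R := ((maximalIdeal.isMaximal R).eq_of_le hKp.ne_top h).symm
      rw [hKm] at hKdim
      rw [ringKrullDim_eq_zero_of_isField
        ((Ideal.Quotient.maximal_ideal_iff_isField_quotient _).mp (maximalIdeal.isMaximal R))]
        at hKdim
      have : (0 : ℕ) = d := by exact_mod_cast hKdim
      omega
  have havoid : ¬ ((I * maximalIdeal R : Ideal R) : Set R) ⊆ ⋃ K ∈ (Tf : Set (Ideal R)), (K : Set R) :=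
    fun hsub => havoid' ((Ideal.subset_union_prime (s := Tf) (f := fun K : Ideal R => K)
      (I * maximalIdeal R) (I * maximalIdeal R)
      (fun K hK _ _ => ((hmemTf K).mp hK).1.1.1)).mp hsub)
  obtain ⟨x, hxP, hx⟩ := Set.not_subset.mp havoid
  refine ⟨x, Ideal.mul_le_right hxP, Ideal.mul_le_left hxP, ?_⟩
  rw [isSecantSequence_singleton_iff]
  refine supportDim_quotSMulTop_lt_of_forall_notMem hd fun p hp hpd hxp => hx ?_
  exact Set.mem_biUnion ((hmemTf p).mpr ⟨hp, hpd⟩) hxp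

end Literature.AlgebraicGeometry.Resolution

end
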